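import Summits.AnomalousDissipation.AnomalousDissipation.Theorems.SawtoothPulseCascadeK1LocalisedCascadeCornerEnvelope
import Mathlib.Analysis.SpecialFunctions.Integrals.Basic

/-!
# K1loc, line `Spectral` / thin start — helper: exact decay mass, amplitude form of the corner envelope, near/far averaging

Helper file of the prover lane on the crux `K1LocalisedCascade` (stmt-AnomalousDissipation-19491), route
`SawtoothPulseCascade` (S-D fibre ledger; memo v9 §9).  Constants bricks for the twist-cut-off half-step
(`…HalfStepVT`): §1 the exact decay mass `∫_T (d₀/max(‖b‖,d₀))² ≤ 4d₀` (for `2πd₀` in `…CornerEnvelope`), its corner-set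
form `≤ |C|·4d₀`, Jensen `(∫f)² ≤ ∫f²` on `T`, and the AMPLITUDE form of the envelope mass
`∫_T (ε₀ + A·d₀/max(infDist(b,C),d₀))² ≤ (ε₀ + A·√(|C|·4d₀))²`; §2 `|∫k·h| ≤ η∫|k| + B∫_{r≤‖s‖}|k|` when `|h| ≤ η` on
`‖s‖ < r` and `|h| ≤ B`, and the translation drop of `infDist`.  No definitions; no statement about the crux.
[cite: Grafakos2014, §3.1.3] [problem: turb]
-/

-- `Summit.<Summit>.<Problem>`: single-conjunct summit, the duplicate namespace segment is deliberate.
set_option linter.dupNamespace false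

noncomputable section

namespace Summit.AnomalousDissipation.AnomalousDissipation.Theorems.SawtoothPulseCascade.K1Window

open MeasureTheory Set Filter Topology Function Metric
open scoped Real ENNReal

/-! ## §1 Exact decay mass and the amplitude form of the envelope -/

/-- `∫_T (d₀/max(‖b‖,d₀))² ≤ 4d₀` (exact value `4d₀ − 4d₀²` for `d₀ ≤ 1/2`). [folklore] -/
theorem integral_decay_sq_le_four {d₀ : ℝ} (hd : 0 < d₀) :
    ∫ b : UnitAddCircle, (d₀ / max ‖b‖ d₀) ^ 2 ≤ 4 * d₀ := by
  have hI : ∀ {f : UnitAddCircle → ℝ}, Continuous f → Integrable f := fun hf =>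
    hf.integrable_of_hasCompactSupport (HasCompactSupport.of_compactSpace _)
  have hc1 : Continuous fun b : UnitAddCircle => (d₀ / max ‖b‖ d₀) ^ 2 :=
    (continuous_const.div (continuous_norm.max continuous_const) fun b => (lt_max_of_lt_right hd).ne').pow 2
  by_cases hbig : 1 / 4 ≤ d₀
  · -- the integrand is at most `1`
    have h1 : ∀ b : UnitAddCircle, (d₀ / max ‖b‖ d₀) ^ 2 ≤ 1 := fun b => by
      have := decay_nonneg_le_one hd ‖b‖
      nlinarith [this.1, this.2]
    refine (integral_mono (hI hc1) (integrable_const 1) h1).trans ?_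
    rw [integral_const, probReal_univ, smul_eq_mul, one_mul]
    linarith
  · push Not at hbig
    -- pass to the interval `(-1/2, 1/2]` and compare with `min 1 (d₀²/x²)` piecewise
    set g : ℝ → ℝ := fun x => (d₀ / max |x| d₀) ^ 2 with hg
    have hgc : Continuous g := (continuous_const.div (continuous_abs.max continuous_const)
      fun x => (lt_max_of_lt_right hd).ne').pow 2
    have hT : ∫ b : UnitAddCircle, (d₀ / max ‖b‖ d₀) ^ 2 = ∫ x in (-(1 / 2 : ℝ))..(-(1 / 2) + 1), g x := by
      rw [← AddCircle.intervalIntegral_preimage 1 (-(1 / 2)) (fun b : UnitAddCircle => (d₀ / max ‖b‖ d₀) ^ 2)]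
      refine intervalIntegral.integral_congr fun x hx => ?_
      have hx' : |x| ≤ 1 / 2 := by
        rw [uIcc_of_le (by norm_num)] at hx
        exact abs_le.mpr ⟨by linarith [hx.1], by linarith [hx.2]⟩
      have hn : ‖(x : UnitAddCircle)‖ = |x| :=
        (AddCircle.norm_coe_eq_abs_iff (1 : ℝ) one_ne_zero).mpr (by simpa using hx')
      simp only [hg, hn]
    rw [hT, show (-(1 / 2 : ℝ) + 1) = 1 / 2 by norm_num]
    have hii : ∀ a b : ℝ, IntervalIntegrable g volume a b := fun a b => hgc.intervalIntegrable _ _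
    rw [← intervalIntegral.integral_add_adjacent_intervals (hii (-(1 / 2)) (-d₀)) (hii (-d₀) (1 / 2)),
      ← intervalIntegral.integral_add_adjacent_intervals (hii (-d₀) d₀) (hii d₀ (1 / 2))]
    -- middle piece: `g = 1`
    have hmid : ∫ x in (-d₀)..d₀, g x = 2 * d₀ := by
      have : ∫ x in (-d₀)..d₀, g x = ∫ x in (-d₀)..d₀, (1 : ℝ) := by
        refine intervalIntegral.integral_congr fun x hx => ?_
        rw [uIcc_of_le (by linarith)] at hx
        have hx' : |x| ≤ d₀ := abs_le.mpr ⟨hx.1, hx.2⟩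
        simp only [hg, max_eq_right hx', div_self hd.ne', one_pow]
      rw [this, intervalIntegral.integral_const, smul_eq_mul, mul_one]; ring
    -- outer pieces: `g = d₀² · x⁻²`
    have hout : ∀ x : ℝ, d₀ ≤ |x| → g x = d₀ ^ 2 * x ^ (-2 : ℤ) := by
      intro x hx
      have hx0 : x ≠ 0 := by
        intro h; rw [h, abs_zero] at hx; linarith
      simp only [hg, max_eq_left hx, div_pow, sq_abs, zpow_neg, zpow_ofNat]
      rw [div_eq_mul_inv]
    have hright : ∫ x in d₀..(1 / 2), g x = d₀ - 2 * d₀ ^ 2 := by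
      have : ∫ x in d₀..(1 / 2), g x = ∫ x in d₀..(1 / 2), d₀ ^ 2 * x ^ (-2 : ℤ) := by
        refine intervalIntegral.integral_congr fun x hx => hout x ?_
        rw [uIcc_of_le (by linarith)] at hx
        rw [abs_of_pos (hd.trans_le hx.1)]; exact hx.1
      have h0 : (0 : ℝ) ∉ uIcc d₀ (1 / 2) := by
        rw [uIcc_of_le (by linarith)]
        exact fun h => by linarith [h.1]
      rw [this, intervalIntegral.integral_const_mul, integral_zpow (Or.inr ⟨by norm_num, h0⟩),
        show (-2 : ℤ) + 1 = -1 by norm_num]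
      simp only [zpow_neg, zpow_one]
      push_cast
      field_simp
      ring
    have hleft : ∫ x in (-(1 / 2))..(-d₀), g x = d₀ - 2 * d₀ ^ 2 := by
      have : ∫ x in (-(1 / 2))..(-d₀), g x = ∫ x in (-(1 / 2))..(-d₀), d₀ ^ 2 * x ^ (-2 : ℤ) := by
        refine intervalIntegral.integral_congr fun x hx => hout x ?_
        rw [uIcc_of_le (by linarith)] at hx
        rw [abs_of_neg (by linarith [hx.2])]; linarith [hx.2]
      have h0 : (0 : ℝ) ∉ uIcc (-(1 / 2)) (-d₀) := by
        rw [uIcc_of_le (by linarith)]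
        exact fun h => by linarith [h.2]
      rw [this, intervalIntegral.integral_const_mul, integral_zpow (Or.inr ⟨by norm_num, h0⟩),
        show (-2 : ℤ) + 1 = -1 by norm_num]
      simp only [zpow_neg, zpow_one]
      push_cast
      field_simp
      ring
    rw [hleft, hmid, hright]
    nlinarith [sq_nonneg d₀]

/-- `∫_T (d₀/max(infDist(b,C),d₀))² ≤ |C|·4d₀` for a finite nonempty corner set `C`. [folklore] -/
theorem integral_decay_sq_infDist_le_four {d₀ : ℝ} (hd : 0 < d₀) (C : Finset UnitAddCircle) (hC : C.Nonempty) :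
    ∫ b : UnitAddCircle, (d₀ / max (infDist b (C : Set UnitAddCircle)) d₀) ^ 2 ≤ C.card * (4 * d₀) := by
  classical
  have hI : ∀ {f : UnitAddCircle → ℝ}, Continuous f → Integrable f := fun hf =>
    hf.integrable_of_hasCompactSupport (HasCompactSupport.of_compactSpace _)
  have hc1 : Continuous fun b : UnitAddCircle => (d₀ / max (infDist b (C : Set UnitAddCircle)) d₀) ^ 2 :=
    (continuous_const.div ((continuous_infDist_pt _).max continuous_const) fun b => (lt_max_of_lt_right hd).ne').pow 2
  have hcc : ∀ c : UnitAddCircle, Continuous fun b : UnitAddCircle => (d₀ / max ‖b - c‖ d₀) ^ 2 := fun c =>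
    (continuous_const.div ((continuous_norm.comp (continuous_id.sub continuous_const)).max continuous_const)
      fun b => (lt_max_of_lt_right hd).ne').pow 2
  refine (integral_mono (hI hc1) (integrable_finsetSum _ fun c _ => hI (hcc c)) (decay_sq_infDist_le_sum d₀ C hC)).trans ?_
  rw [integral_finsetSum _ fun c _ => hI (hcc c)]
  have heach : ∀ c ∈ C, ∫ b : UnitAddCircle, (d₀ / max ‖b - c‖ d₀) ^ 2 ≤ 4 * d₀ := by
    intro c _
    have htr := integral_sub_right_eq_self (μ := (volume : Measure UnitAddCircle)) (fun b : UnitAddCircle => (d₀ / max ‖b‖ d₀) ^ 2) c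
    rw [htr]
    exact integral_decay_sq_le_four hd
  calc ∑ c ∈ C, ∫ b : UnitAddCircle, (d₀ / max ‖b - c‖ d₀) ^ 2 ≤ ∑ c ∈ C, 4 * d₀ := Finset.sum_le_sum heach
    _ = C.card * (4 * d₀) := by rw [Finset.sum_const, nsmul_eq_mul]

/-- Jensen on the probability space `T`: `(∫f)² ≤ ∫f²` for continuous real `f`. [folklore] -/
theorem sq_integral_le_integral_sq {f : UnitAddCircle → ℝ} (hf : Continuous f) :
    (∫ b : UnitAddCircle, f b) ^ 2 ≤ ∫ b : UnitAddCircle, f b ^ 2 := by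
  have hI : ∀ {f : UnitAddCircle → ℝ}, Continuous f → Integrable f := fun hf =>
    hf.integrable_of_hasCompactSupport (HasCompactSupport.of_compactSpace _)
  set m : ℝ := ∫ b : UnitAddCircle, f b with hm
  have h0 : 0 ≤ ∫ b : UnitAddCircle, (f b - m) ^ 2 := integral_nonneg fun b => sq_nonneg _
  have hexp : ∫ b : UnitAddCircle, (f b - m) ^ 2 = (∫ b : UnitAddCircle, f b ^ 2) - m ^ 2 := by
    have e : (fun b : UnitAddCircle => (f b - m) ^ 2) = fun b => f b ^ 2 - 2 * m * f b + m ^ 2 := by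
      funext b; ring
    have hI1 : Integrable fun b : UnitAddCircle => f b ^ 2 := hI (hf.pow 2)
    have hI2 : Integrable fun b : UnitAddCircle => 2 * m * f b := (hI hf).const_mul _
    have hI3 : Integrable fun b : UnitAddCircle => f b ^ 2 - 2 * m * f b := hI1.sub hI2
    rw [e, integral_add hI3 (integrable_const _), integral_sub hI1 hI2, integral_const_mul, integral_const, probReal_univ,
      one_smul, ← hm]
    ring
  linarith

/-- **Amplitude form of the envelope mass**: `∫_T (ε₀ + A·d₀/max(infDist(b,C),d₀))² ≤ (ε₀ + A·√(|C|·4d₀))²`. [folklore] -/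
theorem integral_envelope_sq_le_sq (C : Finset UnitAddCircle) (hC : C.Nonempty) {ε₀ A d₀ : ℝ} (hε : 0 ≤ ε₀) (hA : 0 ≤ A)
    (hd : 0 < d₀) :
    ∫ b : UnitAddCircle, (ε₀ + A * (d₀ / max (infDist b (C : Set UnitAddCircle)) d₀)) ^ 2 ≤
      (ε₀ + A * Real.sqrt (C.card * (4 * d₀))) ^ 2 := by
  have hI : ∀ {f : UnitAddCircle → ℝ}, Continuous f → Integrable f := fun hf =>
    hf.integrable_of_hasCompactSupport (HasCompactSupport.of_compactSpace _)
  set g : UnitAddCircle → ℝ := fun b => d₀ / max (infDist b (C : Set UnitAddCircle)) d₀ with hg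
  have hgc : Continuous g :=
    continuous_const.div ((continuous_infDist_pt _).max continuous_const) fun b => (lt_max_of_lt_right hd).ne'
  have hg0 : ∀ b, 0 ≤ g b := fun b => (decay_nonneg_le_one hd _).1
  set S : ℝ := Real.sqrt (C.card * (4 * d₀)) with hS
  have hS0 : 0 ≤ S := Real.sqrt_nonneg _
  have h2 : ∫ b : UnitAddCircle, g b ^ 2 ≤ S ^ 2 := by
    rw [hS, Real.sq_sqrt (by positivity)]
    exact integral_decay_sq_infDist_le_four hd C hC
  have h1 : ∫ b : UnitAddCircle, g b ≤ S := by
    have hj := sq_integral_le_integral_sq hgc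
    have hi0 : 0 ≤ ∫ b : UnitAddCircle, g b := integral_nonneg hg0
    nlinarith
  have e : (fun b : UnitAddCircle => (ε₀ + A * g b) ^ 2) = fun b => ε₀ ^ 2 + (2 * ε₀ * A * g b + A ^ 2 * g b ^ 2) := by
    funext b; ring
  have hI1 : Integrable fun b : UnitAddCircle => 2 * ε₀ * A * g b := (hI hgc).const_mul _
  have hI2 : Integrable fun b : UnitAddCircle => A ^ 2 * g b ^ 2 := (hI (hgc.pow 2)).const_mul _
  have hI12 : Integrable fun b : UnitAddCircle => 2 * ε₀ * A * g b + A ^ 2 * g b ^ 2 := hI1.add hI2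
  change ∫ b : UnitAddCircle, (ε₀ + A * g b) ^ 2 ≤ (ε₀ + A * S) ^ 2
  rw [e, integral_add (integrable_const _) hI12, integral_add hI1 hI2, integral_const_mul, integral_const_mul,
    integral_const, probReal_univ, one_smul]
  have hεA : 0 ≤ 2 * ε₀ * A := by positivity
  nlinarith [mul_le_mul_of_nonneg_left h1 hεA, mul_le_mul_of_nonneg_left h2 (sq_nonneg A)]

/-! ## §2 Averaging a function that is small near the origin against a kernel -/

/-- If `|h| ≤ η` on `‖s‖ < r` and `|h| ≤ B` everywhere, then `|∫ k·h| ≤ η·∫|k| + B·∫_{r≤‖s‖}|k|`. [folklore] -/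
theorem norm_integral_mul_le_of_near_far {k h : UnitAddCircle → ℂ} (hk : Continuous k) (hh : Continuous h)
    {η B r : ℝ} (hη0 : 0 ≤ η) (hB0 : 0 ≤ B) (hnear : ∀ s, ‖s‖ < r → ‖h s‖ ≤ η) (hfar : ∀ s, ‖h s‖ ≤ B) :
    ‖∫ s : UnitAddCircle, k s * h s‖ ≤
      η * (∫ s : UnitAddCircle, ‖k s‖) + B * ∫ s in {s : UnitAddCircle | r ≤ ‖s‖}, ‖k s‖ := by
  have hI : ∀ {f : UnitAddCircle → ℝ}, Continuous f → Integrable f := fun hf =>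
    hf.integrable_of_hasCompactSupport (HasCompactSupport.of_compactSpace _)
  have hE : MeasurableSet {s : UnitAddCircle | r ≤ ‖s‖} := measurableSet_le measurable_const continuous_norm.measurable
  have hkn : Integrable fun s : UnitAddCircle => ‖k s‖ := hI hk.norm
  have hind : Integrable fun s : UnitAddCircle => ({s : UnitAddCircle | r ≤ ‖s‖}.indicator (fun s => ‖k s‖) s) :=
    hkn.indicator hE
  have hpt : ∀ s : UnitAddCircle, ‖k s * h s‖ ≤
      η * ‖k s‖ + B * {s : UnitAddCircle | r ≤ ‖s‖}.indicator (fun s => ‖k s‖) s := by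
    intro s
    rw [norm_mul]
    by_cases hs : ‖s‖ < r
    · have h1 : ‖k s‖ * ‖h s‖ ≤ ‖k s‖ * η := mul_le_mul_of_nonneg_left (hnear s hs) (norm_nonneg _)
      have h2 : 0 ≤ B * {s : UnitAddCircle | r ≤ ‖s‖}.indicator (fun s => ‖k s‖) s :=
        mul_nonneg hB0 (Set.indicator_nonneg (fun _ _ => norm_nonneg _) _)
      linarith
    · have hmem : s ∈ {s : UnitAddCircle | r ≤ ‖s‖} := not_lt.mp hs
      rw [Set.indicator_of_mem hmem]
      have h1 : ‖k s‖ * ‖h s‖ ≤ ‖k s‖ * B := mul_le_mul_of_nonneg_left (hfar s) (norm_nonneg _)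
      have h2 : 0 ≤ η * ‖k s‖ := mul_nonneg hη0 (norm_nonneg _)
      linarith
  have hI3 : Integrable fun s : UnitAddCircle =>
      η * ‖k s‖ + B * {s : UnitAddCircle | r ≤ ‖s‖}.indicator (fun s => ‖k s‖) s := (hkn.const_mul η).add (hind.const_mul B)
  refine (norm_integral_le_integral_norm _).trans ?_
  refine (integral_mono (hI (hk.mul hh).norm) hI3 hpt).trans ?_
  rw [integral_add (hkn.const_mul η) (hind.const_mul B), integral_const_mul, integral_const_mul, integral_indicator hE]

/-- `infDist` to a set drops by at most `‖s‖` under translation by `s`. [folklore] -/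
theorem infDist_sub_norm_le_infDist_add (C : Set UnitAddCircle) (b s : UnitAddCircle) :
    infDist b C - ‖s‖ ≤ infDist (b + s) C := by
  have h := infDist_le_infDist_add_dist (x := b) (y := b + s) (s := C)
  have hd : dist b (b + s) = ‖s‖ := by rw [dist_eq_norm, sub_add_cancel_left, norm_neg]
  linarith

end Summit.AnomalousDissipation.AnomalousDissipation.Theorems.SawtoothPulseCascade.K1Window
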